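import Summits.BirchSwinnertonDyer.BirchSwinnertonDyer.Theses.SignedLowerHalves
import Summits.BirchSwinnertonDyer.Rank1Residual.Supersingular.KobayashiMainConjecture
import Literature.NumberTheory.EllipticCurves.Rank1Residual.Typed.X7
import HarnessLib

/-!
# Line `rohrlich-squeeze` — crux `KobayashiLowerHalfLargeImage` (route `SignedLowerHalves`, rung K3,
# item stmt-BirchSwinnertonDyer-19001, rank 3): the ONE-DEEP-POINT SQUEEZE

HONEST FRAMING (D-0152). This line feeds the CLASS route K3 = `SignedLowerHalves`, whose deciding
theorem reaches the class leaf `Rank1Residual.Supersingular.SignedSupersingular`; BSD is NOT proved by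
anything here, and the one genuinely open stub below (`stub_deepPointLowerDivisibility_X7`) is, by the
squeeze proved in this file, EQUIVALENT (given Kato's divisibility, in print) to the crux on `p ≥ 5`.
What the line changes is WHERE the crux is attacked: at ONE deep cyclotomic torsion point instead of on
all of `Spec Λ` or at `T = 0`.

## The lever (proved below, sorry-free): rigidity of a divisibility at one point of `Spec Λ`

`Λ = ℤ_p⟦T⟧` is local. Kato (Kobayashi 2003 Thm. 1.3/4.1, tree fact
`Kobayashi2003.thm41_signedCharIdeal_divisibility`, integral under `ρ_{E,p^∞}` onto, which `Surj W p`
gives at `p ≥ 5`) says `ϖ·L^ε_p = g·k` with `(g) = char X^ε`. Let `Φ_n = Φ_{pⁿ}(1+T)` (`cycPhi`), a prime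
of `Λ` with `Λ/(Φ_n) ≅ ℤ_p[ζ_{pⁿ}]` a DVR. If at ONE `n` with `Φ_n ∤ L^ε_p` the OPPOSITE divisibility holds
modulo `Φ_n` — `g ≡ ϖ·L^ε_p·h (mod Φ_n)` for some `h` — then `ḡ = ḡ·k̄·h̄` with `ḡ ≠ 0` in the domain
`Λ/(Φ_n)`, so `k̄h̄ = 1`, so `1 - k h ∈ (Φ_n) ⊆ 𝔪_Λ`, so `k` is a UNIT of `Λ` (`isUnit_of_sup_span_le`,
`isUnit_cofactor_of_pointCongruence`): the Eisenstein half `KobayashiLowerDivisibility W p ε` follows, for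
the sign `ε` one chose. Nothing about `T = 0`, ranks, regulators or Tamagawa numbers enters.

## Why a DEEP point (the dictionary; this is what makes the transferred statement easier, not a costume)

Fix `n ≥ 1` beyond the finitely many cyclotomic divisors of `L^ε_p ≠ 0` (Rohrlich; tree
`MemIwasawaRat.finite_setOf_hasSum_zero`, `pollack_exists_plusMinusPAdicLFunction.interpolation`). When the
parity of `n` matches `ε` (Pollack: odd `n` ↔ `L⁺`, even `n` ↔ `L⁻`), the congruence `g ≡ ϖL^ε h (mod Φ_n)`
is, by (a) Kobayashi's control theorem (Thm. 9.3: restriction `Sel^ε(E/ℚ_n) → Sel^ε(E/ℚ_∞)` injective,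
so `X^ε/Φ_n X^ε ↠ (Sel^ε(E/ℚ_n)^∨)_{Φ_n}`), (b) B. D. Kim's theorem (tree fact
`BDKim2013.thm314_signedSelmerDual_noFiniteSubmodule`: `X^ε` has no finite submodule, so
`ℓ(X^ε/Φ_n X^ε) = ord_{𝔭_n} g(ζ_{pⁿ}-1)` exactly), (c) Kobayashi's unconditional growth computation
(Thm. 1.4, proof §10: `e_n - e_{n-1} = q_n + λ^ε + φ(pⁿ)μ^ε - r_∞`) and (d) Pollack's interpolation
formula at primitive characters `χ` of conductor `p^{n+1}`, EXACTLY the statement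
  «the new part `Sel_{p^∞}(E/ℚ_n)/Sel_{p^∞}(E/ℚ_{n-1})` (= `(σ-1)·Sel(E/ℚ_n)`, `σ` a generator of
   `Gal(ℚ_n/ℚ_{n-1})`) has `ℤ_p`-length ≥ `Σ_{χ of order pⁿ} ord_p (τ(χ)L(E,χ̄,1)/Ω_E) - rank E(ℚ_n)`»,
i.e. the LOWER (non-Kato) half of the `p`-part of BSD for `E` over the single layer `ℚ_n`, new part only —
equivalently the Bloch–Kato lower bound for the `φ(pⁿ)` conjugate RANK-ZERO motives `h¹(E) ⊗ χ`:
* rank 0 and `L(E,χ,1) ≠ 0` for every new `χ` at EVERY analytic rank of `E` (Rohrlich + Kato): the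
  `r_an ≤ 1` frame switch and the `r_an ≥ 2` residue of the `T = 0` evaluation (line `crossing_rigidity`)
  do not arise; the regulator growth is the explicit `- rank E(ℚ_n)`;
* no Tamagawa factor and no torsion at deep layers (`p ≥ 5`: `c_w` is constant up the tower, the number
  of primes over each bad `ℓ` stabilises, `E(ℚ_∞)[p] = 0`), unlike the layer-0 defect `∂^{(∞)} = ord_p ∏ c_ℓ`
  of the line of record `kurihara_rigidity`;
* sign-free and finite-level: no `±` local condition is imposed (it is replaced by the exact local index
  `q_n` of (c)), so `Barriers …SignedNotCongruenceStable` is not met Λ-adically — BUT it reappears at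
  finite level as Raynaud non-uniqueness (`e(ℚ_p(ζ_{p^{n+1}})/ℚ_p) = φ(p^{n+1}) ≥ p-1`): the local
  condition `E(k_n) ⊗ ℚ_p/ℤ_p` is not a function of the Galois module `E[p^m]`, so pure congruence
  engines cannot certify it; engines must produce classes with the condition BUILT IN (Euler-system /
  geometric classes) or count (Kolyvagin-system structure theorems) — see the card;
* freedom in `n`: ANY single deep layer of either parity suffices (the crux asks `∃ ε`), so statements
  "for all sufficiently large `n`" or "for infinitely many `n`" close the crux.

## Stubs (3) and composition

`stub_katoAtPoint` (M; Kato's integral signed divisibility in the `ϖ`-normalisation + `(Φ_n)` prime +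
`Φ_n ∤ g`; `Surj ⇒` tower surjectivity at `p ≥ 5`) — from which `squeezeLift_of_katoAtPoint` PROVES the
lift `C⁺ ⇒ KobayashiLowerDivisibility` with the lever (no period unit needed: both sides carry `ϖ`),
`stub_deepPointLowerDivisibility_X7` (XL; THE open atom, class-wide on the corner),
`stub_three` (the shared `p = 3` residue, verbatim = one item with `kurihara_rigidity`/`crossing_rigidity`);
`KobayashiLowerHalfLargeImage_of` concludes the crux BY NAME from exactly these three.

Dead lines honoured: no Eisenstein congruence at additive level («BSTW lower divisibility unpublished»;
x6 `EisensteinHalfFiveLe` history), no level transport to the semistable locus (DOSSIER-19001 §6, A-lev-13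
withdrawn), no anticyclotomic definite engine for pure-PS X7 curves (sign `-1`, K1G7 note 5), no `T = 0`
value formula (crossing: needs `r_an ≤ 1`).
-/

noncomputable section

open scoped Classical MatrixGroups ModularForm

open CongruenceSubgroup WeierstrassCurve Literature.NumberTheory.EllipticCurves
  Literature.NumberTheory.EllipticCurves.ModularForms
  Literature.NumberTheory.EllipticCurves.Rank1Residual
  Literature.NumberTheory.EllipticCurves.Rank1Residual.Typed
  Literature.NumberTheory.EllipticCurves.Kobayashi2003
  Summit.BirchSwinnertonDyer.Rank1Residual.Supersingular

namespace Summit.BirchSwinnertonDyer.BirchSwinnertonDyer.Cruxes.KobayashiLowerHalfLargeImage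

namespace RohrlichSqueeze

/-! ## Vocabulary: the cyclotomic points of `Spec Λ` -/

/-- The cyclotomic point `Φ_n := Φ_{pⁿ}(1+T) ∈ Λ = ℤ_p⟦T⟧` (`n ≥ 1`): a distinguished irreducible
polynomial, `Λ/(Φ_n) ≅ ℤ_p[ζ_{pⁿ}]`; same spelling as `CommonZeroSqueeze.cycPhi` and the tree's
`FineSelmer.KuriharaPollackGcdProblem`. [cite: KuriharaPollack2007, §3.2] -/
def cycPhi (p : ℕ) [Fact p.Prime] (n : ℕ) : IwasawaAlgebra p :=
  ((((Polynomial.cyclotomic (p ^ n) ℤ).comp (Polynomial.X + 1)).map (Int.castRingHom ℤ_[p]) :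
      Polynomial ℤ_[p]) : PowerSeries ℤ_[p])

/-! ## The lever (PROVED): a divisibility that reverses at one point of a local ring is an equality -/

/-- **One-point rigidity, ideal form.** `R` local, `I ≠ ⊤` an ideal such that `a` is a non-zero-divisor
modulo `I`. If `(I, a) ⊆ (I, a·h)` — i.e. `a·h ∣ a` in `R/I` — then `h` is a unit of `R`.
(Elementary; the `T = 0` instance is Greenberg's use of `f(0)` in LNM 1716 §4.) [folklore] -/
theorem isUnit_of_sup_span_le {R : Type*} [CommRing R] [IsLocalRing R] {I : Ideal R} (hI : I ≠ ⊤)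
    {a h : R} (hnzd : ∀ r : R, a * r ∈ I → r ∈ I)
    (hle : I ⊔ Ideal.span {a} ≤ I ⊔ Ideal.span {a * h}) : IsUnit h := by
  have ha : a ∈ I ⊔ Ideal.span {a * h} :=
    hle (Ideal.mem_sup_right (Ideal.mem_span_singleton_self a))
  obtain ⟨i, hi, y, hy, hiy⟩ := Submodule.mem_sup.mp ha
  obtain ⟨k, rfl⟩ := Ideal.mem_span_singleton'.mp hy
  have hmem : a * (1 - k * h) ∈ I := by
    have h1 : a * (1 - k * h) = i := by linear_combination (-1 : R) * hiy
    rw [h1]; exact hi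
  have h1I : (1 - k * h) ∈ I := hnzd _ hmem
  have hkh : IsUnit (k * h) := by
    by_contra hnu
    have hm : k * h ∈ IsLocalRing.maximalIdeal R := (IsLocalRing.mem_maximalIdeal _).mpr hnu
    have h1m : (1 - k * h) ∈ IsLocalRing.maximalIdeal R := IsLocalRing.le_maximalIdeal hI h1I
    have hone : (1 : R) ∈ IsLocalRing.maximalIdeal R := by
      have := Ideal.add_mem _ h1m hm
      simpa using this
    exact (Ideal.ne_top_iff_one _).mp (IsLocalRing.maximalIdeal.isMaximal R).ne_top hone
  exact isUnit_of_mul_isUnit_right hkh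

/-- **One-point rigidity, congruence form** (the shape `squeezeLift_of_katoAtPoint` uses). In a local ring, let
`q` generate a proper ideal modulo which `g` is a non-zero-divisor (`Λ/(Φ_n)` is a domain and
`Φ_n ∤ g`). If `L = g·k` (Kato's divisibility) and `g ≡ L·h (mod q)` (the lower divisibility AT THE
POINT `q`), then Kato's cofactor `k` is a unit. [folklore] -/
theorem isUnit_cofactor_of_pointCongruence {R : Type*} [CommRing R] [IsLocalRing R] {q g L k h c : R}
    (hq : Ideal.span {q} ≠ ⊤) (hnzd : ∀ r : R, g * r ∈ Ideal.span {q} → r ∈ Ideal.span {q})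
    (hkato : L = g * k) (hpoint : g + q * c = L * h) : IsUnit k := by
  refine isUnit_of_sup_span_le hq hnzd ?_
  -- `(q, g) ≤ (q, g k)`: `g = g k h - q c`.
  have hg : g ∈ Ideal.span {q} ⊔ Ideal.span {g * k} := by
    have hgq : g = (g * k) * h + q * (-c) := by linear_combination hpoint + h * hkato
    have hmem : (g * k) * h + q * (-c) ∈ Ideal.span {q} ⊔ Ideal.span {g * k} :=
      Ideal.add_mem _ (Ideal.mem_sup_right (Ideal.mul_mem_right _ _ (Ideal.mem_span_singleton_self _)))
        (Ideal.mem_sup_left (Ideal.mul_mem_right _ _ (Ideal.mem_span_singleton_self _)))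
    rwa [← hgq] at hmem
  exact sup_le le_sup_left ((Ideal.span_singleton_le_iff_mem _).mpr hg)

/-! ## The transferred statement `C⁺`: lower divisibility at ONE deep cyclotomic point -/

/-- **`C⁺` — the Eisenstein half of Kobayashi's main conjecture for `(E, p, ε)` AT ONE DEEP POINT.**
Same binders as `KobayashiLowerDivisibility W p ε`; the conclusion is weakened from
`char X^ε = (ϖ·L^ε·h)` to: for some `n ≥ 1` with `Φ_n ∤ L^ε_p` (a deep point — all but finitely many
`n` qualify, Rohrlich), `char X^ε = (g)` with `g ≡ ϖ·L^ε_p·h (mod Φ_n)` for some `h, c ∈ Λ` (read in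
`ℚ_p⟦T⟧` because `ϖ ∈ ℚ`). A consequence of `KobayashiLowerDivisibility W p ε` (take `c = 0`), and — by
`isUnit_cofactor_of_pointCongruence` and Kato — equivalent to it at `p ≥ 5` under `Surj`
(`squeezeLift_of_katoAtPoint`). At a layer `n` of parity matching `ε` it READS as the new-part lower `p`-BSD bound
for `E/ℚ_n` (file docstring, "dictionary"). Nothing asserted. -/
def DeepPointLowerDivisibility (W : WeierstrassCurve ℚ) [W.IsElliptic] [W.IsGloballyMinimal]
    (p : ℕ) [Fact p.Prime] (ε : ℤˣ) : Prop :=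
  ∀ (κ : ZpExtension ℚ p) (γ : Field.absoluteGaloisGroup ℚ),
      κ.IsCyclotomic → κ.IsTopGenerator γ → IsCyclotomicVariable p γ →
    ∀ [NeZero (W.conductorNorm ℤ)] (f : CuspForm (Gamma0 (W.conductorNorm ℤ)) 2),
      IsNewformOf W f → ∀ (ϖ : ℚ), (ϖ : ℝ) * W.realPeriodRat = plusPeriod f →
    ∀ (Lplus Lminus : IwasawaAlgebra p), IsPollackPair f p Lplus Lminus →
    ∀ (D : SignedSelmerDualData W κ γ ε),
      ∃ n : ℕ, 1 ≤ n ∧ ¬ (cycPhi p n ∣ kobayashiL ε Lplus Lminus) ∧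
        ∃ g h c : IwasawaAlgebra p, D.charIdeal = Ideal.span {g} ∧
          iwasawaToPowerSeries p (g + cycPhi p n * c) =
            PowerSeries.C (ϖ : ℚ_[p]) * iwasawaToPowerSeries p (kobayashiL ε Lplus Lminus * h)

/-- Sanity (PROVED): the crux's conclusion for a sign implies `C⁺` for that sign as soon as ONE deep
point exists (`Φ_n ∤ L^ε_p` for some `n ≥ 1`, which Rohrlich's theorem supplies for every pair). -/
theorem deepPointLowerDivisibility_of_kobayashiLowerDivisibility {W : WeierstrassCurve ℚ}
    [W.IsElliptic] [W.IsGloballyMinimal] {p : ℕ} [Fact p.Prime] {ε : ℤˣ}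
    (hK : KobayashiLowerDivisibility W p ε)
    (hdeep : ∀ {N : ℕ} [NeZero N] (f : CuspForm (Gamma0 N) 2) (Lplus Lminus : IwasawaAlgebra p),
      IsPollackPair f p Lplus Lminus → ∃ n : ℕ, 1 ≤ n ∧ ¬ (cycPhi p n ∣ kobayashiL ε Lplus Lminus)) :
    DeepPointLowerDivisibility W p ε := by
  intro κ γ hκ hγ hγ' _ f hf ϖ hϖ Lplus Lminus hL D
  obtain ⟨g, h, hg, hι⟩ := hK κ γ hκ hγ hγ' f hf ϖ hϖ Lplus Lminus hL D
  obtain ⟨n, hn, hndvd⟩ := hdeep f Lplus Lminus hL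
  exact ⟨n, hn, hndvd, g, h, 0, hg, by rw [mul_zero, add_zero, hι]⟩

/-! ## Registered stubs -/

/-- STUB (KATO AT THE POINT; size M; provable from print). On the large-image corner at `p ≥ 5`, for a
sign `ε`, every signed datum `D`, every generator `g` of `char X^ε` and every deep point `Φ_n`
(`n ≥ 1`, `Φ_n ∤ L^ε_p`): (i) KATO's integral signed divisibility in the normalisation of
`KobayashiLowerDivisibility` — `ι(g·k) = ϖ·ι(L^ε_p)` for some `k ∈ Λ` (route support items BY NAME:
`SignedLowerHalves.KobayashiSignedKatoDivisibility` = `Kobayashi2003.thm41_signedCharIdeal_divisibility`,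
`SignedLowerHalves.KobayashiSignedSelmerTorsion` = Thm. 1.2; `Surj W p` at `p ≥ 5` ⇒ `ρ_{E,p^m}` onto for
all `m` (Serre); the match `IsSignedPAdicLFunction f p ε (ϖ·L^ε)` for a Pollack pair; integrality of `k` in THIS
`ϖ`-normalisation uses the route's period support item `SignedLowerHalves.RealPeriodUnitPlusPeriod`); (ii) `(Φ_n)` is a
proper ideal of `Λ`; (iii) `g` is a non-zero-divisor modulo `Φ_n` (`Λ/(Φ_n) ≅ ℤ_p[ζ_{pⁿ}]` is a domain by
Weierstrass division, and `Φ_n ∤ g` because `g·k = ϖ·L^ε` up to a power of `p` and `Φ_n ∤ p^s·L^ε`).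
[cite: Kobayashi2003, Thm. 1.2, Thm. 1.3, Thm. 4.1] [cite: Kato2004Asterisque, Thm. 17.4]
[cite: Washington1997, Prop. 7.2 and Lemma 7.5] [cite: Serre1972, §4.4 (lifting surjectivity, p ≥ 5)] -/
theorem stub_katoAtPoint :
    ∀ (W : WeierstrassCurve ℚ) [W.IsElliptic] [W.IsGloballyMinimal] (p : ℕ) [Fact p.Prime],
      5 ≤ p → ClassX7 W p → ¬ W.HasCM → W.frobeniusTrace p = 0 → Surj W p → ∀ (ε : ℤˣ)
      (κ : ZpExtension ℚ p) (γ : Field.absoluteGaloisGroup ℚ),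
      κ.IsCyclotomic → κ.IsTopGenerator γ → IsCyclotomicVariable p γ →
    ∀ [NeZero (W.conductorNorm ℤ)] (f : CuspForm (Gamma0 (W.conductorNorm ℤ)) 2),
      IsNewformOf W f → ∀ (ϖ : ℚ), (ϖ : ℝ) * W.realPeriodRat = plusPeriod f →
    ∀ (Lplus Lminus : IwasawaAlgebra p), IsPollackPair f p Lplus Lminus →
    ∀ (D : SignedSelmerDualData W κ γ ε) (g : IwasawaAlgebra p), D.charIdeal = Ideal.span {g} →
    ∀ (n : ℕ), 1 ≤ n → ¬ (cycPhi p n ∣ kobayashiL ε Lplus Lminus) →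
      (∃ k : IwasawaAlgebra p, iwasawaToPowerSeries p (g * k) =
          PowerSeries.C (ϖ : ℚ_[p]) * iwasawaToPowerSeries p (kobayashiL ε Lplus Lminus)) ∧
      Ideal.span {cycPhi p n} ≠ ⊤ ∧
      (∀ r : IwasawaAlgebra p, g * r ∈ Ideal.span {cycPhi p n} → r ∈ Ideal.span {cycPhi p n}) := by
  sorry

/-- THE SQUEEZE (PROVED from `stub_katoAtPoint` and the lever): on the large-image corner at `p ≥ 5`,
`C⁺` for a sign lifts to the Eisenstein half `KobayashiLowerDivisibility W p ε` for that sign. The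
period ratio `ϖ` never needs to be a unit: both sides are stated in the same `ϖ`-normalisation and
`ι : Λ → ℚ_p⟦T⟧` is injective (`iwasawaToPowerSeries_injective`). -/
theorem squeezeLift_of_katoAtPoint
    (hKato : ∀ (W : WeierstrassCurve ℚ) [W.IsElliptic] [W.IsGloballyMinimal] (p : ℕ) [Fact p.Prime],
      5 ≤ p → ClassX7 W p → ¬ W.HasCM → W.frobeniusTrace p = 0 → Surj W p → ∀ (ε : ℤˣ)
      (κ : ZpExtension ℚ p) (γ : Field.absoluteGaloisGroup ℚ),
      κ.IsCyclotomic → κ.IsTopGenerator γ → IsCyclotomicVariable p γ →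
    ∀ [NeZero (W.conductorNorm ℤ)] (f : CuspForm (Gamma0 (W.conductorNorm ℤ)) 2),
      IsNewformOf W f → ∀ (ϖ : ℚ), (ϖ : ℝ) * W.realPeriodRat = plusPeriod f →
    ∀ (Lplus Lminus : IwasawaAlgebra p), IsPollackPair f p Lplus Lminus →
    ∀ (D : SignedSelmerDualData W κ γ ε) (g : IwasawaAlgebra p), D.charIdeal = Ideal.span {g} →
    ∀ (n : ℕ), 1 ≤ n → ¬ (cycPhi p n ∣ kobayashiL ε Lplus Lminus) →
      (∃ k : IwasawaAlgebra p, iwasawaToPowerSeries p (g * k) =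
          PowerSeries.C (ϖ : ℚ_[p]) * iwasawaToPowerSeries p (kobayashiL ε Lplus Lminus)) ∧
      Ideal.span {cycPhi p n} ≠ ⊤ ∧
      (∀ r : IwasawaAlgebra p, g * r ∈ Ideal.span {cycPhi p n} → r ∈ Ideal.span {cycPhi p n})) :
    ∀ (W : WeierstrassCurve ℚ) [W.IsElliptic] [W.IsGloballyMinimal] (p : ℕ) [Fact p.Prime],
      5 ≤ p → ClassX7 W p → ¬ W.HasCM → W.frobeniusTrace p = 0 → Surj W p →
      ∀ ε : ℤˣ, DeepPointLowerDivisibility W p ε → KobayashiLowerDivisibility W p ε := by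
  intro W _ _ p _ hp5 hX hcm hap hs ε hC κ γ hκ hγ hγ' _ f hf ϖ hϖ Lplus Lminus hL D
  obtain ⟨n, hn1, hndvd, g, h, c, hg, hι⟩ := hC κ γ hκ hγ hγ' f hf ϖ hϖ Lplus Lminus hL D
  obtain ⟨⟨k, hk⟩, hqtop, hnzd⟩ :=
    hKato W p hp5 hX hcm hap hs ε κ γ hκ hγ hγ' f hf ϖ hϖ Lplus Lminus hL D g hg n hn1 hndvd
  have hpoint : g + cycPhi p n * c = (g * k) * h := by
    apply iwasawaToPowerSeries_injective p
    rw [hι, map_mul (iwasawaToPowerSeries p) (g * k) h, hk, map_mul, mul_assoc]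
  have hunit : IsUnit k := isUnit_cofactor_of_pointCongruence hqtop hnzd rfl hpoint
  obtain ⟨u, hu⟩ := hunit
  refine ⟨g, ↑u⁻¹, hg, ?_⟩
  have hgu : g = g * k * ↑u⁻¹ := by rw [← hu, mul_assoc, Units.mul_inv, mul_one]
  calc iwasawaToPowerSeries p g
      = iwasawaToPowerSeries p (g * k * ↑u⁻¹) := by rw [← hgu]
    _ = iwasawaToPowerSeries p (g * k) * iwasawaToPowerSeries p ↑u⁻¹ := map_mul _ _ _
    _ = PowerSeries.C (ϖ : ℚ_[p]) * iwasawaToPowerSeries p (kobayashiL ε Lplus Lminus) *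
          iwasawaToPowerSeries p ↑u⁻¹ := by rw [hk]
    _ = PowerSeries.C (ϖ : ℚ_[p]) * iwasawaToPowerSeries p (kobayashiL ε Lplus Lminus * ↑u⁻¹) := by
          rw [map_mul, mul_assoc]

/-- STUB (THE ATOM; size XL; OPEN — class-wide on the corner, per pair a single-layer statement). For
every X7 pair (`p ≥ 5` good supersingular, `E` not semistable), non-CM, `a_p = 0`, `ρ̄_{E,p}` onto:
`C⁺` holds for SOME sign, i.e. at SOME deep cyclotomic point `Φ_n` the Eisenstein divisibility holds
modulo `Φ_n`. By the dictionary (file docstring) it suffices to prove, at ONE deep layer `ℚ_n` of either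
parity, the new-part lower `p`-BSD bound
`ℓ((σ-1)·Sel_{p^∞}(E/ℚ_n)) ≥ Σ_{ord χ = pⁿ} ord_p(τ(χ)L(E,χ̄,1)/Ω_E) - rank E(ℚ_n)` — rank-0 new part,
no Tamagawa/torsion terms, sign-free. Candidate engines and their obstructions are on the card
(`Ideas/rohrlich-squeeze.md`). Why it might fail AS A PLAN: every known lower-bound engine for twisted
rank-0 BSD at a supersingular `p` with additive primes present is missing (that is the crux); as a
STATEMENT it is implied by Kobayashi's main conjecture. [cite: Kobayashi2003, Thm. 1.4 and §10]
[cite: Pollack2003, Thm. 5.1 (interpolation)] [cite: BDKim2013, Thm. 3.14] -/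
theorem stub_deepPointLowerDivisibility_X7 :
    ∀ (W : WeierstrassCurve ℚ) [W.IsElliptic] [W.IsGloballyMinimal] (p : ℕ) [Fact p.Prime],
      5 ≤ p → ClassX7 W p → ¬ W.HasCM → W.frobeniusTrace p = 0 → Surj W p →
      ∃ ε : ℤˣ, DeepPointLowerDivisibility W p ε := by
  sorry

/-- RESIDUE `p = 3` (honest; verbatim the shared item of `kurihara_rigidity` / `crossing_rigidity`):
Kato's integrality needs `ρ_{E,3^∞}` onto, which `Surj` mod 3 does not give. -/
theorem stub_three :
    ∀ (W : WeierstrassCurve ℚ) [W.IsElliptic] [W.IsGloballyMinimal] (p : ℕ) [Fact p.Prime],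
      p = 3 → ClassX7 W p → ¬ W.HasCM → W.frobeniusTrace p = 0 → Surj W p →
      ∃ ε : ℤˣ, KobayashiLowerDivisibility W p ε := by
  sorry

/-! ## Composition -/

/-- Bookkeeping: an odd prime is `3` or `≥ 5`; at `p ≥ 5` the atom gives a sign with `C⁺` and the lift
turns it into the Eisenstein half. Conclusion = the crux UNFOLDED. -/
theorem lowerHalf_of_squeeze
    (hL : ∀ (W : WeierstrassCurve ℚ) [W.IsElliptic] [W.IsGloballyMinimal] (p : ℕ) [Fact p.Prime],
      5 ≤ p → ClassX7 W p → ¬ W.HasCM → W.frobeniusTrace p = 0 → Surj W p →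
      ∀ ε : ℤˣ, DeepPointLowerDivisibility W p ε → KobayashiLowerDivisibility W p ε)
    (hA : ∀ (W : WeierstrassCurve ℚ) [W.IsElliptic] [W.IsGloballyMinimal] (p : ℕ) [Fact p.Prime],
      5 ≤ p → ClassX7 W p → ¬ W.HasCM → W.frobeniusTrace p = 0 → Surj W p →
      ∃ ε : ℤˣ, DeepPointLowerDivisibility W p ε)
    (h3 : ∀ (W : WeierstrassCurve ℚ) [W.IsElliptic] [W.IsGloballyMinimal] (p : ℕ) [Fact p.Prime],
      p = 3 → ClassX7 W p → ¬ W.HasCM → W.frobeniusTrace p = 0 → Surj W p →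
      ∃ ε : ℤˣ, KobayashiLowerDivisibility W p ε) :
    ∀ (W : WeierstrassCurve ℚ) [W.IsElliptic] [W.IsGloballyMinimal] (p : ℕ) [Fact p.Prime],
      p ≠ 2 → ClassX7 W p → ¬ W.HasCM → W.frobeniusTrace p = 0 → Surj W p →
      ∃ ε : ℤˣ, KobayashiLowerDivisibility W p ε := by
  intro W _ _ p _ hp2 hX hcm hap hs
  have hpP : p.Prime := Fact.out
  by_cases hp5 : 5 ≤ p
  · obtain ⟨ε, hC⟩ := hA W p hp5 hX hcm hap hs
    exact ⟨ε, hL W p hp5 hX hcm hap hs ε hC⟩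
  · have hp3 : p = 3 := by
      have h2le := hpP.two_le
      interval_cases p
      · exact absurd rfl hp2
      · rfl
      · exact absurd hpP (by decide)
    exact h3 W p hp3 hX hcm hap hs

/-- THE SKELETON: the crux BY NAME from exactly the three registered stubs (`stub_katoAtPoint` through the
PROVED squeeze, the atom, the `p = 3` residue); no sorry of its own. -/
theorem KobayashiLowerHalfLargeImage_of :
    Summit.BirchSwinnertonDyer.BirchSwinnertonDyer.Theses.SignedLowerHalves.KobayashiLowerHalfLargeImage :=
  lowerHalf_of_squeeze (squeezeLift_of_katoAtPoint stub_katoAtPoint)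
    stub_deepPointLowerDivisibility_X7 stub_three

end RohrlichSqueeze

end Summit.BirchSwinnertonDyer.BirchSwinnertonDyer.Cruxes.KobayashiLowerHalfLargeImage
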